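import Summits.QuantumFields.YangMills.Theorems.FluctuationComparisonRegPrIntLWregChain
import Summits.QuantumFields.YangMills.Theorems.BalabanUVNodesN09CentralWindowForwardLawAtRecord
import Summits.QuantumFields.YangMills.Theorems.BalabanUVNodesN09CentralWindowInverseContinuous
import Literature.MathematicalPhysics.QuantumFieldTheory.Balaban1983to89.T4AveragingDisintegration
import Literature.MeasureTheory.Function.MeasurableInvFunOn
import HarnessLib

/-!
# WREG PORT F1b — forward Jacobian laws compose; measurability of the chain and of the windows; CHART-VOL and N09's one-step Jacobian with a lower
# bound; fixed-environment continuity of the chain on its compact window (§0d first half · §0v · §0g-I of LINE g18-2)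

Cell `ym3-torus`, width seat `ym3-torus-px13` g8 (helper of `stmt-QuantumFields-20520` = `UnitScaleTilt.FluctuationComparisonRegPrIntL`, `--supports`,
count-neutral).  PORT of the ideator seat ym-r3-idea-1 g18's map `Cruxes/FluctuationComparisonRegPrIntL/Lines/wreg_chart_port.md` (file F1, split in three
≤ 400-line modules F1a ∕ F1b ∕ F1c sharing ONE namespace `Summit.QuantumFields.YangMills.Theorems.FluctuationComparisonRegPrIntLWregChain`): a VERBATIM move of lines 740–979 of the Cruxes workfile
`Cruxes/FluctuationComparisonRegPrIntL/Lines/wreg_chart.lean` v20 (sha16 36befdc7ca5b8719) — `withDensity_map_eq_map_withDensity_comp`, `forwardLaw_comp`, `measurable_chainMap`, `measurable_chainMap₂`, `measurableSet_centralWindowSet`, `chainWindow_succ`, `measurableSet_chainWindow`, `measurableSet_image_chainWindow`, `ChainVol`, `exists_jacobian_forwardLaws_lb`, `continuousOn_avgFun_update_centralWindowSet`, `isClosed_centralWindowSet`, `continuousOn_chainMap_and_isClosed`, `continuousOn_chainMap`, `isClosed_chainWindow`, `isCompact_chainWindow`, `isClosed_image_chainWindow`, `continuousOn_leftInverse_image`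 — so that the organ WREG (`WindowRegularity`) becomes citable BY NAME.
Edits relative to the workfile: namespace, import list (the subset this block uses; NOTHING whose closure contains
`Summits.QuantumFields.BalabanUV.T4Continuum.Support.SubstrateBackground` — the port map's HAZARD), section re-opening at the file seams, and NO heartbeat
budget (the block elaborates at the default and at 100 000).  Statements, docstrings, proofs: unchanged (credit: ideator ym-r3-idea-1 g14–g18; N09 programme).

HONEST FRAMING.  A port proves nothing new.  WREG is ONE organ of S2β `FluctuationPartSmall`; EXW ∕ GAP ∕ LAPLACE ∕ H4ᶜ ∕ LFR♯ᶜ, the polymer line's stubs,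
the run-pair package's seven stubs and the crux `FluctuationComparisonRegPrIntL` (stmt-QuantumFields-20520) are NOT proved; rung R3 = YM₃ on T³ for SU(2) —
NOT d = 4, NOT infinite volume, NOT a mass gap, NOT the Clay problem; nothing of Bałaban's is asserted beyond the cited bookkeeping.
-/

noncomputable section

open MeasureTheory Filter Topology Set
open scoped ENNReal NNReal
open Literature.MathematicalPhysics.QuantumFieldTheory.Balaban1983to89
open Literature.MathematicalPhysics.QuantumFieldTheory.Balaban1983to89.T4Continuum

namespace Summit.QuantumFields.YangMills.Theorems.FluctuationComparisonRegPrIntLWregChain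

/-! ## §0d CHART-ALG II (v7 rung, PROVED; v8: `J` jointly measurable): FORWARD LAWS COMPOSE; the chain's forward Jacobian law on the iterated central window -/

section ChainLawSec

open Function
open Literature.MathematicalPhysics.QuantumFieldTheory.Balaban1983to89.BlockAveraging (Idx avgFun measurable_avgFun)
open Literature.MathematicalPhysics.QuantumFieldTheory.Balaban1983to89.BlockAveragingHaarAC (centralBond centralBond_injective isLocal_avgFun pre post)
open Literature.MathematicalPhysics.QuantumFieldTheory.Balaban1983to89.BlockAveragingEMLHaarAC (fibreFamily offCard)
open Literature.MathematicalPhysics.QuantumFieldTheory.Balaban1983to89.ExpMeanLog (expMeanLogSU deltaSU deltaSU_pos measurable_expMeanLogSU_E)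
open Literature.MathematicalPhysics.QuantumFieldTheory.Balaban1983to89.Node00 (SU)
open Summit.QuantumFields.YangMills.BalabanUVNodes.N09CentralWindowAtRecord (avgFun_update_centralBond_injOn_centralWindow mem_injWindow_of_mem_centralWindow)
open Summit.QuantumFields.YangMills.BalabanUVNodes.N09CentralWindowForwardLaw (isClosed_centralWindowW)
open Summit.QuantumFields.YangMills.BalabanUVNodes.N09CentralWindowForwardLawAtRecord (exists_jacobian_forwardLaws_continuousOn)
open Summit.QuantumFields.YangMills.BalabanUVNodes.N07AveragingLocalContinuity (continuousAt_avgFun_apply_of_small)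
open Summit.QuantumFields.YangMills.BalabanUVNodes.N09CentralWindowInverseContinuous (isClosed_centralWindow)
open Literature.Topology.ParametricInverse (continuousOn_of_isClosed_graph)

variable {P : Params}

section Compose

variable {X Y Z : Type*} [MeasurableSpace X] [MeasurableSpace Y] [MeasurableSpace Z]

/-- `(f_* ρ)·h = f_*(ρ·(h ∘ f))` for measurable `f`, `h`. [folklore] -/
theorem withDensity_map_eq_map_withDensity_comp (ρ : Measure X) {f : X → Y} (hf : Measurable f) {h : Y → ℝ≥0∞} (hh : Measurable h) :
    (ρ.map f).withDensity h = (ρ.withDensity (h ∘ f)).map f := by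
  ext s hs
  rw [withDensity_apply _ hs, Measure.map_apply hf hs, withDensity_apply _ (hf hs), Measure.restrict_map hf hs,
    lintegral_map hh hf]
  rfl

/-- ★ **FORWARD JACOBIAN LAWS COMPOSE.** If `μY⌊f(W) = f_*(J·μX⌊W)` and `μZ⌊F(Ω) = F_*(jac·μY⌊Ω)` with `F` injective on … -/
theorem forwardLaw_comp (μX : Measure X) (μY : Measure Y) (μZ : Measure Z) {f : X → Y} {F : Y → Z} (hf : Measurable f) (hF : Measurable F)
    {W : Set X} {Ω : Set Y} (hΩ : MeasurableSet Ω) {J : X → ℝ≥0∞} {jac : Y → ℝ≥0∞} (hJ : Measurable J) (hjac : Measurable jac)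
    (hinj : InjOn F Ω) (hFS : MeasurableSet (F '' (f '' W ∩ Ω)))
    (lawf : μY.restrict (f '' W) = (((μX.restrict W).withDensity J).map f))
    (lawF : μZ.restrict (F '' Ω) = (((μY.restrict Ω).withDensity jac).map F)) :
    μZ.restrict ((F ∘ f) '' (W ∩ f ⁻¹' Ω)) = ((μX.restrict (W ∩ f ⁻¹' Ω)).withDensity (J * (jac ∘ f))).map (F ∘ f) := by
  have hS : f '' (W ∩ f ⁻¹' Ω) = f '' W ∩ Ω := Set.image_inter_preimage f W Ω
  have himg : (F ∘ f) '' (W ∩ f ⁻¹' Ω) = F '' (f '' W ∩ Ω) := by rw [Set.image_comp, hS]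
  rw [himg]
  have hsub : F '' (f '' W ∩ Ω) ⊆ F '' Ω := Set.image_mono Set.inter_subset_right
  have h1 : μZ.restrict (F '' (f '' W ∩ Ω)) = (μZ.restrict (F '' Ω)).restrict (F '' (f '' W ∩ Ω)) := by
    rw [Measure.restrict_restrict hFS, Set.inter_eq_self_of_subset_left hsub]
  have hpre : F ⁻¹' (F '' (f '' W ∩ Ω)) ∩ Ω = f '' W ∩ Ω := by
    ext y
    constructor
    · rintro ⟨⟨y', hy', hyy⟩, hyΩ⟩
      have : y' = y := hinj hy'.2 hyΩ hyy
      subst this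
      exact hy'
    · intro hy
      exact ⟨⟨y, hy, rfl⟩, hy.2⟩
  rw [h1, lawF, Measure.restrict_map hF hFS, restrict_withDensity (hF hFS), Measure.restrict_restrict (hF hFS), hpre]
  have h2 : μY.restrict (f '' W ∩ Ω) = (μY.restrict (f '' W)).restrict Ω := by
    rw [Measure.restrict_restrict hΩ, Set.inter_comm]
  rw [h2, lawf, Measure.restrict_map hf hΩ, restrict_withDensity (hf hΩ), Measure.restrict_restrict (hf hΩ), Set.inter_comm,
    withDensity_map_eq_map_withDensity_comp _ hf hjac, Measure.map_map hF hf]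
  congr 1
  rw [Set.inter_comm, withDensity_mul _ hJ (hjac.comp hf)]

end Compose

section ChainLaw


variable {N : ℕ} [NeZero N]

/-- The chain map is measurable in the pivot variable. [folklore] -/
theorem measurable_chainMap (n : ℕ) (U : GaugeField P 0 (SU N)) (c : PBond P n) :
    Measurable (chainMap (expMeanLogSU (n := Fin N)) n U c) := by
  unfold chainMap
  have hiter := T4Continuum.measurable_iter (fun i => BlockAveraging.blockAvg (P := P) (j := i) (expMeanLogSU (n := Fin N)))
    (fun j => by rw [BlockAveraging.blockAvg_avg]; exact measurable_avgFun _ measurable_expMeanLogSU_E) n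
  exact (measurable_pi_apply c).comp (hiter.comp (measurable_update U))

/-- The chain map is JOINTLY measurable in the environment and the pivot variable. [folklore] -/
theorem measurable_chainMap₂ (n : ℕ) (c : PBond P n) :
    Measurable fun p : GaugeField P 0 (SU N) × SU N => chainMap (expMeanLogSU (n := Fin N)) n p.1 c p.2 := by
  unfold chainMap
  have hiter := T4Continuum.measurable_iter (fun i => BlockAveraging.blockAvg (P := P) (j := i) (expMeanLogSU (n := Fin N)))
    (fun j => by rw [BlockAveraging.blockAvg_avg]; exact measurable_avgFun _ measurable_expMeanLogSU_E) n
  exact (measurable_pi_apply c).comp (hiter.comp measurable_update')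

/-- The central `α`-window is measurable. [cite: Balaban1987RG1, (0.4) p.253 and (2.9) p.266 (bookkeeping)] -/
theorem measurableSet_centralWindowSet {j : ℕ} (W : GaugeField P j (SU N)) (c : PBond P (j + 1)) (α : ℝ) :
    MeasurableSet (centralWindowSet W c α) :=
  ((isClosed_centralWindowW W c α).preimage ((continuous_const.mul continuous_id).mul continuous_const)).measurableSet

/-- The successor iterated window, as an intersection with a preimage (definitional). [folklore] -/
theorem chainWindow_succ (α : ℝ) (n : ℕ) (U : GaugeField P 0 (SU N)) (c : PBond P (n + 1)) :
    chainWindow α (n + 1) U c = chainWindow α n U (centralBond c) ∩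
      chainMap (expMeanLogSU (n := Fin N)) n U (centralBond c) ⁻¹'
        centralWindowSet (Averaging.iter (fun i => BlockAveraging.blockAvg (P := P) (j := i) (expMeanLogSU (n := Fin N))) n U) c α :=
  Set.ext fun _ => Iff.rfl

/-- The iterated central window is measurable. [folklore] -/
theorem measurableSet_chainWindow (α : ℝ) : ∀ (n : ℕ) (U : GaugeField P 0 (SU N)) (c : PBond P n), MeasurableSet (chainWindow α n U c)
  | 0, _, _ => MeasurableSet.univ
  | n + 1, U, c => by
      rw [chainWindow_succ]
      exact (measurableSet_chainWindow α n U (centralBond c)).inter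
        ((measurable_chainMap n U (centralBond c)) (measurableSet_centralWindowSet
          (Averaging.iter (fun i => BlockAveraging.blockAvg (P := P) (j := i) (expMeanLogSU (n := Fin N))) n U) c α))

/-- The image window of the chain is measurable (Lusin–Souslin, from `chainMap_injOn`). [cite: Kechris1995, Thm 15.1] -/
theorem measurableSet_image_chainWindow {α : ℝ} (hα0 : 0 ≤ α) (hα : α ≤ 1 / 24) (hαδ : α < deltaSU (Fin N))
    (hgap : ∀ j (c : PBond P (j + 1)), (offCard c : ℝ) / (Fintype.card (Idx P) : ℝ) + 150 * α < 1) {n : ℕ} (hn : n ≤ P.m + P.K)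
    (U : GaugeField P 0 (SU N)) (c : PBond P n) {S : Set (SU N)} (hS : MeasurableSet S) (hSW : S ⊆ chainWindow α n U c) :
    MeasurableSet (chainMap (expMeanLogSU (n := Fin N)) n U c '' S) :=
  hS.image_of_measurable_injOn (measurable_chainMap n U c) ((chainMap_injOn hα0 hα hαδ hgap hn U c).mono hSW)

/-! ### §0v CHART-VOL: uniform volume non-compression of the one-step (0.4) average on central windows ⇒ a one-step Jacobian bounded BELOW -/

/-- **CHART-VOL at `P`** (chart-free). [cite: Balaban1987RG1, (0.4) p.253 and (2.10) p.267] -/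
def ChainVol (P : Params) (N : ℕ) [NeZero N] (α : ℝ) (j₀ : ℝ≥0) : Prop :=
  ∀ (j : ℕ), j + 1 ≤ P.m + P.K → ∀ (W : GaugeField P j (SU N)) (c : PBond P (j + 1)) (A : Set (SU N)), MeasurableSet A →
    A ⊆ centralWindowSet W c α →
      (j₀ : ℝ≥0∞) * (HaarData.haar : Measure (SU N)) A ≤
        (HaarData.haar : Measure (SU N)) ((fun g : SU N => avgFun (expMeanLogSU (n := Fin N)) (update W (centralBond c) g) c) '' A)

/-- ★ N09's one-step Jacobian, with a lower bound under CHART-VOL (or trivially `j₀ = 0`). [cite: Balaban1987RG1, (0.4) p.253 and (2.10) p.267] -/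
theorem exists_jacobian_forwardLaws_lb {j : ℕ} (hj : j + 1 ≤ P.m + P.K) {α : ℝ} (hα0 : 0 ≤ α) (hα24 : α ≤ 1 / 24)
    (hα64 : 64 * α ≤ deltaSU (Fin N)) (hαL : 157 * α < ((P.L : ℝ) ^ (P.d - 1))⁻¹)
    (hgap : ∀ c : PBond P (j + 1), (offCard c : ℝ) / (Fintype.card (Idx P) : ℝ) + 150 * α < 1)
    {j₀ : ℝ≥0} (hvol : j₀ = 0 ∨ ChainVol P N α j₀) :
    ∃ jac : PBond P (j + 1) → GaugeField P j (SU N) → SU N → ℝ≥0,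
      (∀ c, Measurable fun p : GaugeField P j (SU N) × SU N => jac c p.1 p.2) ∧
      (∀ c U g, g ∈ centralWindowSet U c α → jac c U g ≠ 0) ∧
      (∀ c U, (HaarData.haar : Measure (SU N)).restrict
          ((fun g : SU N => avgFun (expMeanLogSU (n := Fin N)) (update U (centralBond c) g) c) '' centralWindowSet U c α) =
        (((HaarData.haar : Measure (SU N)).restrict (centralWindowSet U c α)).withDensity fun g => (jac c U g : ℝ≥0∞)).map
          (fun g : SU N => avgFun (expMeanLogSU (n := Fin N)) (update U (centralBond c) g) c)) ∧
      (∀ c U, ContinuousOn (jac c U) (centralWindowSet U c α)) ∧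
      (∀ c U g, j₀ ≤ jac c U g) := by
  have hαδ : α < deltaSU (Fin N) := by nlinarith [deltaSU_pos (n := Fin N)]
  obtain ⟨jac, hm, h0, hlaw, hc⟩ := exists_jacobian_forwardLaws_continuousOn (N := N) (P := P) hj hα0 hα24 hα64 hαL hgap
  by_cases hj₀ : j₀ = 0
  · exact ⟨jac, hm, fun c U g hg => h0 c U g hg, fun c U => hlaw c U, fun c U => hc c U, fun c U g => by rw [hj₀]; exact bot_le⟩
  have hvol' : ChainVol P N α j₀ := hvol.resolve_left hj₀
  have hj₀' : 0 < j₀ := pos_iff_ne_zero.2 hj₀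
  refine ⟨fun c U g => max (jac c U g) j₀, fun c => (hm c).max measurable_const, fun c U g _ => (lt_of_lt_of_le hj₀' (le_max_right _ _)).ne',
    fun c U => ?_, fun c U => continuous_max.comp_continuousOn ((hc c U).prodMk continuousOn_const), fun c U g => le_max_right _ _⟩
  dsimp only
  set Ω := centralWindowSet U c α with hΩ
  set Fm := fun g : SU N => avgFun (expMeanLogSU (n := Fin N)) (update U (centralBond c) g) c with hFm_def
  have hΩm : MeasurableSet Ω := measurableSet_centralWindowSet U c α
  have hFmeas : Measurable Fm := (measurable_pi_apply c).comp ((measurable_avgFun _ measurable_expMeanLogSU_E).comp (measurable_update _))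
  have hinj : InjOn Fm Ω := fun g₁ hg₁ g₂ hg₂ h => avgFun_update_centralBond_injOn_centralWindow hj _ c hα0 hα24 hαδ (hgap c) hg₁ hg₂ h
  have hae : ∀ᵐ g ∂(HaarData.haar : Measure (SU N)).restrict Ω, (j₀ : ℝ≥0∞) ≤ (jac c U g : ℝ≥0∞) := by
    refine ae_le_of_forall_setLIntegral_le_of_sigmaFinite measurable_const fun s hs _ => ?_
    have hA : MeasurableSet (s ∩ Ω) := hs.inter hΩm
    have hFA : MeasurableSet (Fm '' (s ∩ Ω)) := hA.image_of_measurable_injOn hFmeas (hinj.mono inter_subset_right)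
    have h1 : ∫⁻ _ in s, (j₀ : ℝ≥0∞) ∂(HaarData.haar : Measure (SU N)).restrict Ω = (j₀ : ℝ≥0∞) * (HaarData.haar : Measure (SU N)) (s ∩ Ω) := by
      rw [Measure.restrict_restrict hs, setLIntegral_const]
    have h2 : ∫⁻ g in s, (jac c U g : ℝ≥0∞) ∂(HaarData.haar : Measure (SU N)).restrict Ω = (HaarData.haar : Measure (SU N)) (Fm '' (s ∩ Ω)) := by
      have hlaw' : (HaarData.haar : Measure (SU N)).restrict (Fm '' Ω) =
          (((HaarData.haar : Measure (SU N)).restrict Ω).withDensity fun g => (jac c U g : ℝ≥0∞)).map Fm := hlaw c U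
      have happ := congrArg (fun μ : Measure (SU N) => μ (Fm '' (s ∩ Ω))) hlaw'
      rw [Measure.restrict_apply hFA, Set.inter_eq_left.2 (Set.image_mono inter_subset_right), Measure.map_apply hFmeas hFA,
        withDensity_apply _ (hFmeas hFA), Measure.restrict_restrict (hFmeas hFA), hinj.preimage_image_inter inter_subset_right] at happ
      rw [Measure.restrict_restrict hs, happ]
    rw [h1, h2]
    exact hvol' j hj U c (s ∩ Ω) hA inter_subset_right
  have hcongr : ((HaarData.haar : Measure (SU N)).restrict Ω).withDensity (fun g => ((max (jac c U g) j₀ : ℝ≥0) : ℝ≥0∞)) =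
      ((HaarData.haar : Measure (SU N)).restrict Ω).withDensity fun g => (jac c U g : ℝ≥0∞) := by
    refine withDensity_congr_ae ?_
    filter_upwards [hae] with g hg
    rw [max_eq_left (by exact_mod_cast hg)]
  rw [hcongr]
  exact hlaw c U

/-! ### §0g CHART-REG (fibre direction) I: fixed-environment continuity of the chain on its compact window. -/

/-- The one-step (0.4) average at a fixed environment, as a map of the central variable. [cite: Balaban1987RG1, (0.4) p.253] -/
theorem continuousOn_avgFun_update_centralWindowSet {j : ℕ} (hj : j + 1 ≤ P.m + P.K) (W : GaugeField P j (SU N)) (c : PBond P (j + 1)) {α : ℝ}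
    (hαδ : α < deltaSU (Fin N)) :
    ContinuousOn (fun h : SU N => avgFun (expMeanLogSU (n := Fin N)) (update W (centralBond c) h) c) (centralWindowSet W c α) := by
  intro h hh
  have hsmall : BlockAveraging.Small (expMeanLogSU (n := Fin N)) (update W (centralBond c) h) c :=
    (mem_injWindow_of_mem_centralWindow hj c hαδ W hh).1
  have hu : Continuous fun h' : SU N => update W (centralBond c) h' := continuous_const.update (centralBond c) continuous_id
  exact ((continuousAt_avgFun_apply_of_small c hsmall).comp hu.continuousAt).continuousWithinAt

/-- The central `α`-window at a fixed environment is closed. [cite: Balaban1987RG1, (0.4) p.253 (bookkeeping)] -/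
theorem isClosed_centralWindowSet {j : ℕ} (W : GaugeField P j (SU N)) (c : PBond P (j + 1)) (α : ℝ) : IsClosed (centralWindowSet W c α) :=
  isClosed_centralWindow c α W

/-- ★ At a fixed environment the chain is continuous on the iterated window and the window is compact. [cite: Balaban1987RG1, (0.4) p.253 and p.267] -/
theorem continuousOn_chainMap_and_isClosed {α : ℝ} (hαδ : α < deltaSU (Fin N)) :
    ∀ {n : ℕ}, n ≤ P.m + P.K → ∀ (U : GaugeField P 0 (SU N)) (c : PBond P n),
      ContinuousOn (chainMap (expMeanLogSU (n := Fin N)) n U c) (chainWindow α n U c) ∧ IsClosed (chainWindow α n U c)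
  | 0, _ => fun U c => by
      have h0 : chainMap (expMeanLogSU (n := Fin N)) 0 U c = id := funext fun g => chainMap_zero _ U c g
      have hW0 : chainWindow α 0 U c = Set.univ := rfl
      rw [h0, hW0]
      exact ⟨continuousOn_id, isClosed_univ⟩
  | n + 1, hn => fun U c => by
      obtain ⟨hf, hW⟩ := continuousOn_chainMap_and_isClosed hαδ (n := n) (by omega) U (centralBond c)
      have hcomp : chainMap (expMeanLogSU (n := Fin N)) (n + 1) U c =
          (fun g => avgFun (expMeanLogSU (n := Fin N)) (update
            (Averaging.iter (fun i => BlockAveraging.blockAvg (P := P) (j := i) (expMeanLogSU (n := Fin N))) n U) (centralBond c) g) c) ∘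
            chainMap (expMeanLogSU (n := Fin N)) n U (centralBond c) := funext fun g => chainMap_succ _ hn U c g
      rw [hcomp, chainWindow_succ]
      refine ⟨(continuousOn_avgFun_update_centralWindowSet (N := N) (by omega) _ c hαδ).comp (hf.mono inter_subset_left) fun g hg => hg.2, ?_⟩
      exact hf.preimage_isClosed_of_isClosed hW (isClosed_centralWindowSet _ c α)

/-- The chain map is continuous on its iterated central window (first half of `continuousOn_chainMap_and_isClosed`). [cite: Balaban1987RG1, (0.4) p.253 and (2.9) p.266 (bookkeeping)] -/
theorem continuousOn_chainMap {α : ℝ} (hαδ : α < deltaSU (Fin N)) {n : ℕ} (hn : n ≤ P.m + P.K) (U : GaugeField P 0 (SU N)) (c : PBond P n) :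
    ContinuousOn (chainMap (expMeanLogSU (n := Fin N)) n U c) (chainWindow α n U c) :=
  (continuousOn_chainMap_and_isClosed hαδ hn U c).1

/-- The iterated central window is closed (second half of `continuousOn_chainMap_and_isClosed`). [cite: Balaban1987RG1, (0.4) p.253 and (2.9) p.266 (bookkeeping)] -/
theorem isClosed_chainWindow {α : ℝ} (hαδ : α < deltaSU (Fin N)) {n : ℕ} (hn : n ≤ P.m + P.K) (U : GaugeField P 0 (SU N)) (c : PBond P n) :
    IsClosed (chainWindow α n U c) :=
  (continuousOn_chainMap_and_isClosed hαδ hn U c).2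

/-- The iterated central window is compact (closed in the compact group). [cite: Balaban1987RG1, (0.4) p.253 and (2.9) p.266 (bookkeeping)] -/
theorem isCompact_chainWindow {α : ℝ} (hαδ : α < deltaSU (Fin N)) {n : ℕ} (hn : n ≤ P.m + P.K) (U : GaugeField P 0 (SU N)) (c : PBond P n) :
    IsCompact (chainWindow α n U c) :=
  (isClosed_chainWindow hαδ hn U c).isCompact

/-- The image window `chainMap n U c '' chainWindow α n U c` is compact, hence closed. [folklore] -/
theorem isClosed_image_chainWindow {α : ℝ} (hαδ : α < deltaSU (Fin N)) {n : ℕ} (hn : n ≤ P.m + P.K) (U : GaugeField P 0 (SU N)) (c : PBond P n) :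
    IsClosed (chainMap (expMeanLogSU (n := Fin N)) n U c '' chainWindow α n U c) :=
  ((isCompact_chainWindow hαδ hn U c).image_of_continuousOn (continuousOn_chainMap hαδ hn U c)).isClosed

/-- Closed-graph inverse on a compact window (generic topology). [cite: BourbakiGT1, Ch. I §10 no. 2, Thm 1 Cor. 5] -/
theorem continuousOn_leftInverse_image {X Y : Type*} [TopologicalSpace X] [CompactSpace X] [TopologicalSpace Y] [T2Space Y]
    {f : X → Y} {K : Set X} (hK : IsClosed K) (hf : ContinuousOn f K) (hinj : InjOn f K) {θ : Y → X}
    (hθK : ∀ v ∈ f '' K, θ v ∈ K) (hθ : ∀ v ∈ f '' K, f (θ v) = v) : ContinuousOn θ (f '' K) := by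
  have hφ : ContinuousOn (fun r : Y × X => (f r.2, r.1)) (Prod.snd ⁻¹' K) :=
    (hf.comp continuous_snd.continuousOn fun r hr => hr).prodMk continuous_fst.continuousOn
  have hΓ : IsClosed (Prod.snd ⁻¹' K ∩ (fun r : Y × X => (f r.2, r.1)) ⁻¹' diagonal Y) :=
    hφ.preimage_isClosed_of_isClosed (hK.preimage continuous_snd) isClosed_diagonal
  refine continuousOn_of_isClosed_graph (Γ := Prod.snd ⁻¹' K ∩ (fun r : Y × X => (f r.2, r.1)) ⁻¹' diagonal Y) hΓ ?_ ?_
  · intro v hv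
    exact ⟨hθK v hv, by simpa [mem_diagonal_iff] using hθ v hv⟩
  · rintro v hv x ⟨hxK, hx⟩
    have hx' : f x = v := by simpa [mem_diagonal_iff] using hx
    exact hinj hxK (hθK v hv) (hx'.trans (hθ v hv).symm)


end ChainLaw

end ChainLawSec

end Summit.QuantumFields.YangMills.Theorems.FluctuationComparisonRegPrIntLWregChain

end
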